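import Summits.BirchSwinnertonDyer.BirchSwinnertonDyer.Theses.PrintX11a
import Summits.BirchSwinnertonDyer.BirchSwinnertonDyer.Theorems.PrintX11aNonSurjEulerHalfBranchesDefs
import Summits.BirchSwinnertonDyer.BirchSwinnertonDyer.Theorems.ClassRecordThreeCornerAtThreeTwinKatoFacts
import Summits.BirchSwinnertonDyer.BirchSwinnertonDyer.Theorems.ErratumRoadFiveNonSurjCornerBranchesAn
import Summits.BirchSwinnertonDyer.BirchSwinnertonDyer.Theorems.PrintX11aEulerHalfGlue
import HarnessLib

/-!
# Route `PrintX11a` (cell `bsd-print-x11a`, seat p3), crux 3 `X11aNonSurjEulerHalf` (item stmt-BirchSwinnertonDyer-20406):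
# the GLUE of a by-name split — children (`X11aNonSurjMu[An][AtThree]` ∕ the K2 constants at `p ∈ {5,7}`) ∧ ONE
# conjunction of NAMED facts ⟹ the crux BY NAME; and the split of the `μ`-object itself is lossless
# (`--supports stmt-BirchSwinnertonDyer-20406`)

Companion of `Theorems/PrintX11aNonSurjEulerHalfOfMu.lean` (p539522; fact binders one by one; NOT imported here — this module sits
directly on the route file, theses-cone lint) composed with the Theses-free
constants of `Theorems/PrintX11aNonSurjEulerHalfBranchesDefs.lean` (p540710) and of the K2 corner split
(`Theorems.NonSurjCornerTwinMu`, item 19948 `Theses.ErratumRoadFive.NonSurjCornerTwinMuAn`), so that a planner's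
`route edit --split X11aNonSurjEulerHalf --into …` can type every child BY NAME and paste ONE support conjunction:

* `x11aNonSurjEulerHalf_of_mu_of_facts : X11aNonSurjMu → ⟨12 facts⟩ → X11aNonSurjEulerHalf` (literal road);
* `x11aNonSurjEulerHalf_of_muAn_of_facts : X11aNonSurjMuAn → ⟨13 facts⟩ → X11aNonSurjEulerHalf` (analytic road; the
  13th fact is the construction fact `Kato2004.exists_multDivisibilityInputs_fine`, F1-mult of the corner's μ-transfer);
* `x11aNonSurjEulerHalf_of_muAtThree_of_twinMu_of_facts : X11aNonSurjMuAtThree → NonSurjCornerTwinMu → ⟨12 facts ∧ BDMTV⟩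
  → X11aNonSurjEulerHalf` and `x11aNonSurjEulerHalf_of_muAnAtThree_of_twinMuAn_of_facts : X11aNonSurjMuAnAtThree →
  Theses.ErratumRoadFive.NonSurjCornerTwinMuAn → ⟨13 facts ∧ BDMTV⟩ → X11aNonSurjEulerHalf` — the SHARED-STAFFING shape:
  the `p ∈ {5,7}` child IS the K2 route's object (item 19948 by name), only the `p = 3` child (`3Ns/3Nn`) is new;
* `x11aNonSurjMu_iff_atThree_and_twinMu`, `x11aNonSurjMuAn_iff_atThree_and_twinMuAn` — the split of the μ-object is
  LOSSLESS (modulo Balakrishnan et al. 2019 for the locus `p ∈ {5,7} ∧ p ∣ ord_p Δ_min` ⇐ `¬Surj ∧ 5 ≤ p`);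
* `x11aNonSurjMu_of_muAn` — analytic ⟹ literal at every non-surjective X11a pair (corner-p1 g6's μ-transfer WITHOUT
  big image at `p ∥ N`, `X11b.MultMu.mu_eq_zero_of_multFine`, modulo F1-mult and Wuthrich Cor. 18; data — newform,
  period ratio, Mazur–Tate–Teitelbaum function — instantiated from tree theorems as in the corner engine).

HONEST FRAMING. THEOREMS ONLY (no definition, no named fact minted, no `sorry`); CONDITIONAL on the displayed children
(OPEN `Prop` constants) and fact conjunctions (named `def … : Prop` Literature statements; three CONSTRUCTION facts flagged
`Kato-17.11-at-nonsplit-mult = Wu14-p391`, `Kato-17.11-at-split-mult = Ko06-Thm4.1`, `Kato-p280-image-at-mult` (F1-mult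
only)); item 20406 does NOT close; the leaf `ClassX11a` stays open; BSD is not advanced; no census word moves.
«beyond-print theorem: NO».

References: [GreenbergLNM1716] Conj. 1.11 (p. 61), Thm. 1.5; [Kato2004Asterisque] Thm. 12.4–12.6, §17.13 (pp. 279–280);
[Wuthrich2014] Cor. 18 (p. 398), Prop. 21 (p. 400); [SteinWuthrich2013] Thm. 6.1; [BalakrishnanEtAl2019] Thm. 1.2;
tree: p539522, p540710 (this seat), `Theorems/ErratumRoadFiveNonSurjCorner{BranchesDefs,MuTransferMult,TwinKatoEngine}.lean`.
-/

set_option autoImplicit false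
set_option linter.dupNamespace false

noncomputable section

open scoped Classical NumberField MatrixGroups ModularForm

open CongruenceSubgroup WeierstrassCurve Field
  Literature.NumberTheory.EllipticCurves
  Literature.NumberTheory.EllipticCurves.ModularForms
  Literature.NumberTheory.EllipticCurves.Rank1Residual
  Literature.NumberTheory.EllipticCurves.Rank1Residual.Typed
  Literature.NumberTheory.EllipticCurves.Wuthrich2014
  Literature.NumberTheory.EllipticCurves.SteinWuthrich2013
  Literature.NumberTheory.EllipticCurves.Greenberg1999
  Literature.NumberTheory.EllipticCurves.Kato2004
  Literature.NumberTheory.EllipticCurves.BalakrishnanEtAl2019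
  Summit.BirchSwinnertonDyer.Rank1Residual
  Summit.BirchSwinnertonDyer.Rank1Residual.X11b

namespace Summit.BirchSwinnertonDyer.BirchSwinnertonDyer.Theorems

/-! ### §1 The μ-object: its split into `p = 3` and `p ∈ {5,7}` is lossless; analytic ⟹ literal -/

/-- **`X11aNonSurjMu ↔ X11aNonSurjMuAtThree ∧ NonSurjCornerTwinMu`** (the literal μ-object of crux 3 is EXACTLY its
`p = 3` child and the K2 corner's literal child at `p ∈ {5,7}`): the locus `p ∈ {5,7} ∧ p ∣ ord_p Δ_min` of a
non-surjective X11a pair with `p ≠ 3` is Balakrishnan et al. 2019 (`hB`) + Tate's transvection (`x11a_not_surj_locus`).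
[cite: BalakrishnanEtAl2019, §1 Thm. 1.2 (arXiv:1711.05846 p. 2)] [cite: GreenbergLNM1716, §1 Conj. 1.11 (shape)] -/
theorem x11aNonSurjMu_iff_atThree_and_twinMu (hB : thm12_not_le_normalizer_splitCartan) :
    X11aNonSurjMu ↔ X11aNonSurjMuAtThree ∧ NonSurjCornerTwinMu := by
  constructor
  · intro h
    exact ⟨fun W _ _ p _ hX hns _ => h W p hX hns, fun W _ _ p _ hX hns _ _ => h W p hX hns⟩
  · rintro ⟨h3, h57⟩ W _ _ p _ hX hns κ γ hκ hγ hγ' D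
    obtain ⟨h357, hvd, -⟩ := x11a_not_surj_locus hB hX hns
    rcases h357 with h3' | h57'
    · exact h3 W p hX hns h3' κ γ hκ hγ hγ' D
    · exact h57 W p hX hns h57' hvd κ γ hκ hγ hγ' D

/-- **`X11aNonSurjMuAn ↔ X11aNonSurjMuAnAtThree ∧ NonSurjCornerTwinMuAn`** (item 19948's body) — the analytic
μ-object splits losslessly the same way. [cite: BalakrishnanEtAl2019, §1 Thm. 1.2 (arXiv:1711.05846 p. 2)]
[cite: GreenbergLNM1716, §1 Conj. 1.11 (shape)] [cite: Wuthrich2014, Cor. 18 (p. 398)] -/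
theorem x11aNonSurjMuAn_iff_atThree_and_twinMuAn (hB : thm12_not_le_normalizer_splitCartan) :
    X11aNonSurjMuAn ↔
      X11aNonSurjMuAnAtThree ∧ Summit.BirchSwinnertonDyer.BirchSwinnertonDyer.Theses.ErratumRoadFive.NonSurjCornerTwinMuAn := by
  constructor
  · intro h
    refine ⟨fun W _ _ p _ hX hns _ => h W p hX hns, ?_⟩
    show NonSurjCornerTwinMuAn
    exact fun W _ _ p _ hX hns _ _ => h W p hX hns
  · rintro ⟨h3, h57⟩ W _ _ p _ hX hns N _ f hf ϖ hϖ a L hsa hna hL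
    have h57' : NonSurjCornerTwinMuAn := h57
    obtain ⟨h357, hvd, -⟩ := x11a_not_surj_locus hB hX hns
    rcases h357 with h3' | h57''
    · exact h3 W p hX hns h3' f hf ϖ hϖ a L hsa hna hL
    · exact h57' W p hX hns h57'' hvd f hf ϖ hϖ a L hsa hna hL

/-- **Analytic ⟹ literal at every non-surjective X11a pair**: `X11aNonSurjMuAn → X11aNonSurjMu`, by corner-p1 g6's
KERNEL-CHECKED `μ`-transfer without big image at `p ∥ N` (`X11b.MultMu.mu_eq_zero_of_multFine`: a unit coefficient
of `ϖ·L` ⟹ a genuine Euler-system class `∉ p𝐇¹` ⟹ the reduction-free core ⟹ `μ(X) = 0`; it USES `Irr ∧ ¬Surj`),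
modulo F1-mult (`hfine`) and Wuthrich Cor. 18 (`h18`); the newform, the period ratio and THE Mazur–Tate–Teitelbaum
function are instantiated from tree theorems (`hpar`, `exists_isSplitMultPAdicLFunctionOf`,
`exists_isMultPAdicLFunctionOf_neg_one_of_nonsplit`). CONDITIONAL; nothing asserted about any curve.
[cite: Kato2004Asterisque, Thm. 12.6 (p. 222), (14.9.3) (p. 240), §17.13 (pp. 279–280)]
[cite: Wuthrich2014, p. 391 and Cor. 18 (p. 398)] [cite: GreenbergLNM1716, §1 Conj. 1.11 (shape)] -/
theorem x11aNonSurjMu_of_muAn (hpar : nonempty_modularParametrizationData)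
    (hfine : Kato2004.exists_multDivisibilityInputs_fine)
    (h18 : Wuthrich2014.corollary18_padicLFunction_mem_iwasawaAlgebra_multiplicative)
    (hAn : X11aNonSurjMuAn) : X11aNonSurjMu := by
  intro W _ _ p _ hX hns κ γ hκ hγ hγ' D
  haveI : NeZero (W.conductorNorm ℤ) := ⟨(W.conductorNorm_pos_holds).ne'⟩
  obtain ⟨Dm⟩ := hpar W
  obtain ⟨ϖ, -, hϖ, -⟩ := Dm.exists_rat_mul_realPeriodRat_eq_plusPeriod
  have hp2 : p ≠ 2 := hX.ne_two
  have hmult : Mult W p := hX.mult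
  by_cases hsplit : W.HasSplitMultiplicativeReductionAtPrime p
  · obtain ⟨L, hL⟩ := exists_isSplitMultPAdicLFunctionOf hsplit Dm.isNewformOf
    have hL1 : IsMultPAdicLFunctionOf Dm.f p 1 L := (isMultPAdicLFunctionOf_one_iff L).mpr hL
    exact MultMu.mu_eq_zero_of_multFine hfine h18 W p Dm.f hp2 hmult hX.irr hns Dm.isNewformOf ϖ hϖ 1 L
      (fun _ => rfl) (fun hns' => absurd hsplit hns') hL1
      (hAn W p hX hns Dm.f Dm.isNewformOf ϖ hϖ 1 L (fun _ => rfl) (fun hns' => absurd hsplit hns') hL1)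
      κ γ hκ hγ hγ' D
  · obtain ⟨L, hL⟩ := exists_isMultPAdicLFunctionOf_neg_one_of_nonsplit Dm.isNewformOf hmult hsplit
    exact MultMu.mu_eq_zero_of_multFine hfine h18 W p Dm.f hp2 hmult hX.irr hns Dm.isNewformOf ϖ hϖ (-1) L
      (fun hs => absurd hs hsplit) (fun _ => rfl) hL
      (hAn W p hX hns Dm.f Dm.isNewformOf ϖ hϖ (-1) L (fun hs => absurd hs hsplit) (fun _ => rfl) hL)
      κ γ hκ hγ hγ' D

/-! ### §2 The glue: children ∧ ONE fact conjunction ⟹ the crux BY NAME -/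

/-- **GLUE (literal road): `X11aNonSurjMu → ⟨twelve named facts⟩ → X11aNonSurjEulerHalf`.** The conjunction is, in
order: Stein–Wuthrich 2013 Thm. 6.1 split ∕ non-split, GZK, modularity (entire `L`), modular parametrisation data,
Greenberg–Stevens (family), Kato 2004 (12.2.1), Thm. 12.4, §17.13 inputs at a non-split ∕ split multiplicative odd prime
(CONSTRUCTION facts), Greenberg 1999 Thm. 1.5, Wuthrich 2014 Cor. 18 — verbatim the binders of
`x11aNonSurjEulerHalf_of_katoFacts_of_muZero` (p539522). CONDITIONAL; closes nothing by itself.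
[cite: GreenbergLNM1716, §1 Conj. 1.11 (shape)] [cite: Kato2004Asterisque, §17.13 (pp. 279–280)]
[cite: Wuthrich2014, Cor. 18 (p. 398)] [cite: SteinWuthrich2013, Thm. 6.1 (p. 20)] -/
theorem x11aNonSurjEulerHalf_of_mu_of_facts (hμ : X11aNonSurjMu)
    (hF : Literature.NumberTheory.EllipticCurves.SteinWuthrich2013.thm61_splitMultiplicative ∧
      Literature.NumberTheory.EllipticCurves.SteinWuthrich2013.thm61_nonsplitMultiplicative ∧
      Literature.NumberTheory.EllipticCurves.rank_eq_analyticRank_of_analyticRank_le_one ∧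
      WeierstrassCurve.hasEntireLFunction_rat ∧
      Literature.NumberTheory.EllipticCurves.ModularForms.nonempty_modularParametrizationData ∧
      (∀ (W : WeierstrassCurve ℚ) [W.IsElliptic] [W.IsGloballyMinimal] (p : ℕ) [Fact p.Prime],
        Literature.NumberTheory.EllipticCurves.greenberg_stevens (W := W) (p := p)) ∧
      Literature.NumberTheory.EllipticCurves.Kato2004.nonempty_iwasawaH1Data ∧
      Literature.NumberTheory.EllipticCurves.Kato2004.thm12_4 ∧
      Literature.NumberTheory.EllipticCurves.Kato2004.exists_multDivisibilityInputs_nonsplit ∧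
      Literature.NumberTheory.EllipticCurves.Kato2004.exists_multDivisibilityInputs_split ∧
      Literature.NumberTheory.EllipticCurves.Greenberg1999.thm15_isTorsion_multiplicative_rat ∧
      Literature.NumberTheory.EllipticCurves.Wuthrich2014.corollary18_padicLFunction_mem_iwasawaAlgebra_multiplicative) :
    Summit.BirchSwinnertonDyer.BirchSwinnertonDyer.Theses.PrintX11a.X11aNonSurjEulerHalf := by
  obtain ⟨hJs, hJn, hGZK, hmod, hpar, hGS, hne, h12, hns, hsp, h15, h18⟩ := hF
  intro W _ _ p _ hX hnsj
  exact missingUpperBoundAt_of_katoFacts_of_corollary18_of_mu_eq_zero hJs hJn hGZK hmod hpar hne h12 hns hsp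
    h15 h18 W p (hGS W p) hX.ne_two hX.mult hX.analyticRank_eq_zero (hμ W p hX hnsj)

/-- **GLUE (analytic road): `X11aNonSurjMuAn → ⟨thirteen named facts⟩ → X11aNonSurjEulerHalf`** — the twelve of the
literal road followed by `Kato2004.exists_multDivisibilityInputs_fine` (F1-mult); verbatim the binders of
`x11aNonSurjEulerHalf_of_katoFacts_of_muAn` (p539522). CONDITIONAL; closes nothing by itself.
[cite: GreenbergLNM1716, §1 Conj. 1.11 (shape)] [cite: Kato2004Asterisque, Thm. 12.6 (p. 222) and §17.13 (pp. 279–280)]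
[cite: Wuthrich2014, p. 391 and Cor. 18 (p. 398)] [cite: SteinWuthrich2013, Thm. 6.1 (p. 20)] -/
theorem x11aNonSurjEulerHalf_of_muAn_of_facts (hAn : X11aNonSurjMuAn)
    (hF : Literature.NumberTheory.EllipticCurves.SteinWuthrich2013.thm61_splitMultiplicative ∧
      Literature.NumberTheory.EllipticCurves.SteinWuthrich2013.thm61_nonsplitMultiplicative ∧
      Literature.NumberTheory.EllipticCurves.rank_eq_analyticRank_of_analyticRank_le_one ∧
      WeierstrassCurve.hasEntireLFunction_rat ∧
      Literature.NumberTheory.EllipticCurves.ModularForms.nonempty_modularParametrizationData ∧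
      (∀ (W : WeierstrassCurve ℚ) [W.IsElliptic] [W.IsGloballyMinimal] (p : ℕ) [Fact p.Prime],
        Literature.NumberTheory.EllipticCurves.greenberg_stevens (W := W) (p := p)) ∧
      Literature.NumberTheory.EllipticCurves.Kato2004.nonempty_iwasawaH1Data ∧
      Literature.NumberTheory.EllipticCurves.Kato2004.thm12_4 ∧
      Literature.NumberTheory.EllipticCurves.Kato2004.exists_multDivisibilityInputs_nonsplit ∧
      Literature.NumberTheory.EllipticCurves.Kato2004.exists_multDivisibilityInputs_split ∧
      Literature.NumberTheory.EllipticCurves.Greenberg1999.thm15_isTorsion_multiplicative_rat ∧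
      Literature.NumberTheory.EllipticCurves.Wuthrich2014.corollary18_padicLFunction_mem_iwasawaAlgebra_multiplicative ∧
      Literature.NumberTheory.EllipticCurves.Kato2004.exists_multDivisibilityInputs_fine) :
    Summit.BirchSwinnertonDyer.BirchSwinnertonDyer.Theses.PrintX11a.X11aNonSurjEulerHalf := by
  obtain ⟨hJs, hJn, hGZK, hmod, hpar, hGS, hne, h12, hns, hsp, h15, h18, hfine⟩ := hF
  intro W _ _ p _ hX hnsj
  exact missingUpperBoundAt_of_classX11a_of_multDivisibilityAt hJs hJn hGZK hmod hpar W p (hGS W p) hX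
    (multDivisibilityAt_of_katoFacts_of_muAn hne h12 hns hsp h15 h18 hfine W p hX.ne_two hX.mult hX.irr hnsj
      (hAn W p hX hnsj))

/-- **GLUE (literal road, shared-staffing shape): `X11aNonSurjMuAtThree → NonSurjCornerTwinMu → ⟨twelve facts ∧
BDMTV⟩ → X11aNonSurjEulerHalf`** — the `p ∈ {5,7}` child is the K2 corner split's literal constant, the `p = 3` child is
the new constant; the last conjunct `BalakrishnanEtAl2019.thm12_not_le_normalizer_splitCartan` supplies the locus.
CONDITIONAL; closes nothing by itself. [cite: BalakrishnanEtAl2019, §1 Thm. 1.2 (arXiv:1711.05846 p. 2)]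
[cite: GreenbergLNM1716, §1 Conj. 1.11 (shape)] [cite: Kato2004Asterisque, §17.13 (pp. 279–280)] [cite: Wuthrich2014, Cor. 18 (p. 398)] -/
theorem x11aNonSurjEulerHalf_of_muAtThree_of_twinMu_of_facts (h3 : X11aNonSurjMuAtThree)
    (h57 : NonSurjCornerTwinMu)
    (hF : Literature.NumberTheory.EllipticCurves.SteinWuthrich2013.thm61_splitMultiplicative ∧
      Literature.NumberTheory.EllipticCurves.SteinWuthrich2013.thm61_nonsplitMultiplicative ∧
      Literature.NumberTheory.EllipticCurves.rank_eq_analyticRank_of_analyticRank_le_one ∧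
      WeierstrassCurve.hasEntireLFunction_rat ∧
      Literature.NumberTheory.EllipticCurves.ModularForms.nonempty_modularParametrizationData ∧
      (∀ (W : WeierstrassCurve ℚ) [W.IsElliptic] [W.IsGloballyMinimal] (p : ℕ) [Fact p.Prime],
        Literature.NumberTheory.EllipticCurves.greenberg_stevens (W := W) (p := p)) ∧
      Literature.NumberTheory.EllipticCurves.Kato2004.nonempty_iwasawaH1Data ∧
      Literature.NumberTheory.EllipticCurves.Kato2004.thm12_4 ∧
      Literature.NumberTheory.EllipticCurves.Kato2004.exists_multDivisibilityInputs_nonsplit ∧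
      Literature.NumberTheory.EllipticCurves.Kato2004.exists_multDivisibilityInputs_split ∧
      Literature.NumberTheory.EllipticCurves.Greenberg1999.thm15_isTorsion_multiplicative_rat ∧
      Literature.NumberTheory.EllipticCurves.Wuthrich2014.corollary18_padicLFunction_mem_iwasawaAlgebra_multiplicative ∧
      Literature.NumberTheory.EllipticCurves.BalakrishnanEtAl2019.thm12_not_le_normalizer_splitCartan) :
    Summit.BirchSwinnertonDyer.BirchSwinnertonDyer.Theses.PrintX11a.X11aNonSurjEulerHalf := by
  obtain ⟨hJs, hJn, hGZK, hmod, hpar, hGS, hne, h12, hns, hsp, h15, h18, hB⟩ := hF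
  have hμ : X11aNonSurjMu := (x11aNonSurjMu_iff_atThree_and_twinMu hB).mpr ⟨h3, h57⟩
  intro W _ _ p _ hX hnsj
  exact missingUpperBoundAt_of_katoFacts_of_corollary18_of_mu_eq_zero hJs hJn hGZK hmod hpar hne h12 hns hsp
    h15 h18 W p (hGS W p) hX.ne_two hX.mult hX.analyticRank_eq_zero (hμ W p hX hnsj)

/-- **GLUE (analytic road, shared-staffing shape): `X11aNonSurjMuAnAtThree → NonSurjCornerTwinMuAn (item
stmt-BirchSwinnertonDyer-19948, BY NAME) → ⟨thirteen facts ∧ BDMTV⟩ → X11aNonSurjEulerHalf`** — ONE proof of 19948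
serves both routes; only the `p = 3` child is new. CONDITIONAL; closes nothing by itself.
[cite: BalakrishnanEtAl2019, §1 Thm. 1.2 (arXiv:1711.05846 p. 2)] [cite: GreenbergLNM1716, §1 Conj. 1.11 (shape)]
[cite: Kato2004Asterisque, Thm. 12.6 (p. 222) and §17.13 (pp. 279–280)] [cite: Wuthrich2014, p. 391 and Cor. 18 (p. 398)] -/
theorem x11aNonSurjEulerHalf_of_muAnAtThree_of_twinMuAn_of_facts (h3 : X11aNonSurjMuAnAtThree)
    (h57 : Summit.BirchSwinnertonDyer.BirchSwinnertonDyer.Theses.ErratumRoadFive.NonSurjCornerTwinMuAn)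
    (hF : Literature.NumberTheory.EllipticCurves.SteinWuthrich2013.thm61_splitMultiplicative ∧
      Literature.NumberTheory.EllipticCurves.SteinWuthrich2013.thm61_nonsplitMultiplicative ∧
      Literature.NumberTheory.EllipticCurves.rank_eq_analyticRank_of_analyticRank_le_one ∧
      WeierstrassCurve.hasEntireLFunction_rat ∧
      Literature.NumberTheory.EllipticCurves.ModularForms.nonempty_modularParametrizationData ∧
      (∀ (W : WeierstrassCurve ℚ) [W.IsElliptic] [W.IsGloballyMinimal] (p : ℕ) [Fact p.Prime],
        Literature.NumberTheory.EllipticCurves.greenberg_stevens (W := W) (p := p)) ∧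
      Literature.NumberTheory.EllipticCurves.Kato2004.nonempty_iwasawaH1Data ∧
      Literature.NumberTheory.EllipticCurves.Kato2004.thm12_4 ∧
      Literature.NumberTheory.EllipticCurves.Kato2004.exists_multDivisibilityInputs_nonsplit ∧
      Literature.NumberTheory.EllipticCurves.Kato2004.exists_multDivisibilityInputs_split ∧
      Literature.NumberTheory.EllipticCurves.Greenberg1999.thm15_isTorsion_multiplicative_rat ∧
      Literature.NumberTheory.EllipticCurves.Wuthrich2014.corollary18_padicLFunction_mem_iwasawaAlgebra_multiplicative ∧
      Literature.NumberTheory.EllipticCurves.Kato2004.exists_multDivisibilityInputs_fine ∧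
      Literature.NumberTheory.EllipticCurves.BalakrishnanEtAl2019.thm12_not_le_normalizer_splitCartan) :
    Summit.BirchSwinnertonDyer.BirchSwinnertonDyer.Theses.PrintX11a.X11aNonSurjEulerHalf := by
  obtain ⟨hJs, hJn, hGZK, hmod, hpar, hGS, hne, h12, hns, hsp, h15, h18, hfine, hB⟩ := hF
  have hAn : X11aNonSurjMuAn := (x11aNonSurjMuAn_iff_atThree_and_twinMuAn hB).mpr ⟨h3, h57⟩
  intro W _ _ p _ hX hnsj
  exact missingUpperBoundAt_of_classX11a_of_multDivisibilityAt hJs hJn hGZK hmod hpar W p (hGS W p) hX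
    (multDivisibilityAt_of_katoFacts_of_muAn hne h12 hns hsp h15 h18 hfine W p hX.ne_two hX.mult hX.irr hnsj
      (hAn W p hX hnsj))

end Summit.BirchSwinnertonDyer.BirchSwinnertonDyer.Theorems

end
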